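import Literature.AnabelianGeometry.SemiGraphs.TemperedCurveDataNonVacuity
import Literature.NumberTheory.LocalFields.PadicGaloisSecondCountable
import HarnessLib

/-!
# `GroupLevelData` / `TemperedArithmeticGroup` at a GENUINE `p`-adic base: the Galois-countability
# binder discharged ([SemiAnbd] Ex. 3.10 / [IUTchI] Rmk 2.5.3 (i) (T1))

Mochizuki, *Semi-graphs of anabelioids*, Publ. RIMS **42** (2006) [SemiAnbd], Example 3.10 pp. 43–45
("`Π := π₁^temp(X^log_K)` … `1 → Δ → Π → G_K → 1` … both `Δ` and `Π` are temp-slim") and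
*Inter-universal Teichmüller theory I*, Remark 2.5.3 (i) (T1) p. 52 ("Galois-countable": "its topology
admits a countable basis"). [cite: MochizukiSemiAnbd2006, Ex 3.10 pp.43-45]

PROOF-ONLY closer (abc-iut cell, NV lane «NV-L3/TemperedCurve.GroupLevelData», prover abc-iut-w5-d040
with the consent of the row holder abc-iut-w5-d149, STATUS 05:14:07Z).  abc-iut-w5-d149's
`TemperedCurveDataNonVacuity.lean` inhabits the parameter bundle `TemperedCurve.GroupLevelData` at the
model `TemperedCurve.degenerate p` (`K = ℚ_p`, `Π := G_{ℚ_p}`, `Δ = 1`) under ONE instance hypothesis,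
`[SecondCountableTopology (GQp p)]` — Galois-countability of `G_{ℚ_p}`, which [IUTchI] Rmk 2.5.3 (ii)
(E1) states only for COUNTABLE fields.  `PadicGaloisSecondCountable.lean` (abc-iut-w5-d040) PROVES it
for `G_{ℚ_p}` from Krasner's finiteness theorem (`PadicFiniteSubextensions.lean`, Mathlib-only), so:

* `TemperedCurve.nonempty_groupLevelData_degenerate'` — `Nonempty (GroupLevelData (degenerate p))`,
  UNCONDITIONAL;
* `TemperedCurve.exists_toTemperedArithmeticGroup_degenerate'` — the bridge of abc-iut-L3-lead's ruling
  η fires unconditionally at the degenerate model;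
* (The literal-type form `Nonempty (TemperedArithmeticGroup ℚ_[p])` is abc-iut-w5-d218's
  `TemperedArithmeticGroup.nonempty_model_padic`, `TemperedArithmeticGroupPadicWitness.lean`, landed
  first — cited, not restated.)

HONEST LABELS: ARITHMETIC side GENUINE (the true `G_{ℚ_p}`: tempered as a profinite group, slim by
[pGC] Lemma 15.8 PROVED in the tree, Galois-countable by Krasner finiteness PROVED in the tree);
GEOMETRIC side DEGENERATE (`Δ = 1`; a hyperbolic curve has nonabelian `Δ`) — for a non-degenerate `Δ`
see `TemperedCurveGroupLevelDataNonVacuity2.lean`.  A witness is consistency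
evidence for an interface, not an endorsement; nothing of [SemiAnbd]/[IUTchI] is asserted; no side is
taken on [IUTchIII] Cor. 3.12.
-/

noncomputable section

namespace Literature.AnabelianGeometry.SemiGraphs

open Literature.NumberTheory.LocalFields

namespace TemperedCurve

variable {p : ℕ} [Fact p.Prime]

/-- **`GroupLevelData` at the degenerate model over `ℚ_p`, UNCONDITIONAL**: abc-iut-w5-d149's
`nonempty_groupLevelData_degenerate` with its one instance hypothesis `SecondCountableTopology (GQp p)`
discharged by `secondCountableTopology_galQp` (Krasner finiteness ⇒ Galois-countability of `G_{ℚ_p}`).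
Arithmetic side genuine, geometric side degenerate (`Δ = 1`).
[cite: MochizukiSemiAnbd2006, Ex 3.10 pp.43-45] -/
theorem nonempty_groupLevelData_degenerate' : Nonempty (GroupLevelData (degenerate p)) := by
  haveI : SecondCountableTopology (GQp p) := secondCountableTopology_galQp p
  exact nonempty_groupLevelData_degenerate

/-- The bridge of ruling η fires unconditionally at the degenerate model: a `TemperedArithmeticGroup`
datum of [SemiAnbd] Ex. 3.10 over `(degenerate p).K = ℚ_p` with `Π := G_{ℚ_p}`.
[cite: MochizukiSemiAnbd2006, Ex 3.10 p.43] -/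
theorem exists_toTemperedArithmeticGroup_degenerate' :
    ∃ d : GroupLevelData (degenerate p), ((degenerate p).toTemperedArithmeticGroup d).Pi = GQp p := by
  haveI : SecondCountableTopology (GQp p) := secondCountableTopology_galQp p
  exact exists_toTemperedArithmeticGroup_degenerate

end TemperedCurve

end Literature.AnabelianGeometry.SemiGraphs

end
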